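import Literature.Probability.Percolation.SharpnessDCTProofs
import Literature.Probability.Percolation.PercolationProofs
import HarnessLib

/-!
# Continuity from above for the label-coupled anisotropic model
(`stub_thetaInf` of line `locmod`, crux `CriticalCurveRegular`, stmt-CriticalPhenomena-16065)

Anisotropic bond percolation on `ℤ²×ℤ` is driven by i.i.d. uniform labels `U`
(`labelMeasure (Site 3)`): the configuration `cfg p t U = {e ∈ E(ℤ³) | (e vertical ∧ U e ≤ t) ∨
(e horizontal ∧ U e ≤ p)}` is always carried by `E(ℤ³)`. We prove
`μ{cfg p t ∈ {|C(0)| = ∞}} = ⨅ₙ μ{cfg p t ∈ {0 ↔ ∂Λ_n in Λ_n}}` for all real `p, t`: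

* for `ω ⊆ E(ℤ^d)`: `{|C(0)| = ∞} ⊆ {0 ↔ ∂Λ_n}` (an infinite cluster leaves `Λ_n`; first exit,
  `DCT16.armEvent_of_pathIn`) and `{0 ↔ ∂Λ_n} ⊆ {0 ↔ ∂Λ_m}` for `m ≤ n`; together with
  `DCT16.iInter_siteToBoundary_subset_percolatesAt` this gives, for any map `cfg` into
  configurations carried by `E(ℤ^d)`, `{cfg ∈ {|C(0)| = ∞}} = ⋂ₙ {cfg ∈ {0 ↔ ∂Λ_n}}` with an
  antitone right-hand side (surely, no null sets);
* continuity of a finite measure from above (`Antitone.measure_iInter`) and `ENNReal.toReal_iInf`;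
* measurability of `U ↦ cfg p t U` coordinatewise (`measurable_set_iff`).

Sources: Grimmett, *Percolation* (1999), §1.4 (`θ(p) = lim P_p(0 ↔ ∂B(n))`);
Duminil-Copin–Tassion (2016), §2.2; patterns of `DCT16.theta_le_real_siteToBoundary`,
`DCT16.real_siteToBoundary_antitone`, `DCT16.le_theta_of_forall_le_real_siteToBoundary`.
-/

noncomputable section

open MeasureTheory Set
open Literature.Probability.Percolation Literature.Probability.LatticeModels

namespace Summit.CriticalPhenomena.PercolationContinuityZ3.Cruxes.CriticalCurveRegular.Locmod

namespace ThetaInf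

/-- **First exit of an infinite cluster**: for `ω ⊆ E(ℤ^d)`, if `|C(0)| = ∞` then `0 ↔ ∂Λ_n`
inside `Λ_n` for every `n` (body of `DCT16.theta_le_real_siteToBoundary`; Grimmett 1999, §1.4).
[folklore] -/
theorem mem_siteToBoundary_of_mem_percolatesAt {d : ℕ} {ω : BondConfig (Site d)}
    (hω : ω ⊆ (zdGraph d).edgeSet) (h : ω ∈ percolatesAt (0 : Site d)) (n : ℕ) :
    ω ∈ siteToBoundary d n := by
  obtain ⟨z, hz, hzn⟩ : ∃ z ∈ openCluster ω 0, z ∉ box d n := by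
    by_contra hcon
    push Not at hcon
    exact h ((box d n).finite_toSet.subset fun z hz => Finset.mem_coe.2 (hcon z hz))
  rw [← DCT16.armEvent_zero]
  exact DCT16.armEvent_of_pathIn hω (DCT16.pathIn_univ_of_reachable hz)
    (Or.inl (by rwa [sub_zero]))

/-- **First exit from a smaller box**: for `ω ⊆ E(ℤ^d)` and `m ≤ n`, `0 ↔ ∂Λ_n` in `Λ_n` implies
`0 ↔ ∂Λ_m` in `Λ_m` (body of `DCT16.real_siteToBoundary_antitone`; Duminil-Copin–Tassion 2016,
§2.1). [folklore] -/
theorem mem_siteToBoundary_of_le {d : ℕ} {ω : BondConfig (Site d)}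
    (hω : ω ⊆ (zdGraph d).edgeSet) {m n : ℕ} (hmn : m ≤ n) (h : ω ∈ siteToBoundary d n) :
    ω ∈ siteToBoundary d m := by
  rw [← DCT16.armEvent_zero]
  rw [DCT16.mem_siteToBoundary_iff] at h
  obtain ⟨y, hy, hpath⟩ := h
  refine DCT16.armEvent_of_pathIn hω hpath ?_
  rcases hmn.lt_or_eq with hlt | rfl
  · exact Or.inl (by rw [sub_zero]; exact DCT16.notMem_box_of_mem_innerBoundary_box hlt hy)
  · exact Or.inr (by rw [sub_zero]; exact hy)

/-- For a map `cfg` into configurations carried by `E(ℤ^d)`: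
`{cfg ∈ {|C(0)| = ∞}} = ⋂ₙ {cfg ∈ {0 ↔ ∂Λ_n}}` (surely). [folklore] -/
theorem setOf_mem_percolatesAt_eq_iInter {d : ℕ} {Ω : Type*} (cfg : Ω → BondConfig (Site d))
    (hsub : ∀ U, cfg U ⊆ (zdGraph d).edgeSet) :
    {U | cfg U ∈ percolatesAt (0 : Site d)} = ⋂ n, {U | cfg U ∈ siteToBoundary d n} := by
  ext U
  simp only [Set.mem_setOf_eq, Set.mem_iInter]
  exact ⟨fun h n => mem_siteToBoundary_of_mem_percolatesAt (hsub U) h n,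
    fun h => DCT16.iInter_siteToBoundary_subset_percolatesAt d (Set.mem_iInter.2 h)⟩

/-- For a map `cfg` into configurations carried by `E(ℤ^d)`, `n ↦ {cfg ∈ {0 ↔ ∂Λ_n}}` is
non-increasing (surely). [folklore] -/
theorem antitone_setOf_mem_siteToBoundary {d : ℕ} {Ω : Type*} (cfg : Ω → BondConfig (Site d))
    (hsub : ∀ U, cfg U ⊆ (zdGraph d).edgeSet) :
    Antitone fun n => {U | cfg U ∈ siteToBoundary d n} :=
  fun _ _ hmn U hU => mem_siteToBoundary_of_le (hsub U) hmn hU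

/-- **Continuity from above** for the pull-back of the arm events under a measurable map `cfg`
into configurations carried by `E(ℤ^d)`, for a finite measure `μ`:
`μ{cfg ∈ {|C(0)| = ∞}} = ⨅ₙ μ{cfg ∈ {0 ↔ ∂Λ_n}}` (Grimmett 1999, §1.4). [folklore] -/
theorem measureReal_setOf_mem_percolatesAt_eq_iInf {d : ℕ} {Ω : Type*} [MeasurableSpace Ω]
    (μ : Measure Ω) [IsFiniteMeasure μ] {cfg : Ω → BondConfig (Site d)} (hcfg : Measurable cfg)
    (hsub : ∀ U, cfg U ⊆ (zdGraph d).edgeSet) :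
    μ.real {U | cfg U ∈ percolatesAt (0 : Site d)} =
      ⨅ n, μ.real {U | cfg U ∈ siteToBoundary d n} := by
  have hmeas : ∀ n, MeasurableSet {U | cfg U ∈ siteToBoundary d n} :=
    fun n => hcfg (DCT16.measurableSet_siteToBoundary d n)
  have key : μ (⋂ n, {U | cfg U ∈ siteToBoundary d n}) =
      ⨅ n, μ {U | cfg U ∈ siteToBoundary d n} :=
    (antitone_setOf_mem_siteToBoundary cfg hsub).measure_iInter
      (fun n => (hmeas n).nullMeasurableSet) ⟨0, measure_ne_top _ _⟩
  rw [setOf_mem_percolatesAt_eq_iInter cfg hsub, measureReal_def, key,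
    ENNReal.toReal_iInf fun n => measure_ne_top _ _]
  simp only [measureReal_def]

/-- The anisotropic label coupling `U ↦ cfg p t U` is measurable: each coordinate event
`{e ∈ cfg p t U}` is a constant combination of the cylinders `{U e ≤ t}`, `{U e ≤ p}`
(pattern `measurable_configOfLabels`; Grimmett 1999, §1.3). [folklore] -/
theorem measurable_cfg (p t : ℝ) :
    Measurable fun U : Sym2 (Site 3) → ℝ =>
      ({e | e ∈ (zdGraph 3).edgeSet ∧
        (((∃ x : Site 3, e = s(x, x + Pi.single (2 : Fin 3) 1)) ∧ U e ≤ t) ∨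
          (¬ (∃ x : Site 3, e = s(x, x + Pi.single (2 : Fin 3) 1)) ∧ U e ≤ p))} :
        BondConfig (Site 3)) := by
  refine measurable_set_iff.2 fun e => ?_
  simp only [Set.mem_setOf_eq]
  have ht : Measurable fun U : Sym2 (Site 3) → ℝ => U e ≤ t :=
    (measurableSet_setOf.1 measurableSet_Iic).comp (measurable_pi_apply e)
  have hp : Measurable fun U : Sym2 (Site 3) → ℝ => U e ≤ p :=
    (measurableSet_setOf.1 measurableSet_Iic).comp (measurable_pi_apply e)
  exact measurable_const.and ((measurable_const.and ht).or (measurable_const.and hp))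

end ThetaInf

/-- **stub 3 (registered) = `Stubs.stub_thetaInf` verbatim — continuity from above.**
`θ(p,t) = μ{cfg p t ∈ {|C(0)| = ∞}} = ⨅ₙ μ{cfg p t ∈ {0 ↔ ∂Λ_n in Λ_n}}` for all real `p, t`
(Grimmett 1999, §1.4, `θ(p) = lim P_p(0 ↔ ∂B(n))`, transported to the label space: `cfg p t U`
is always carried by `E(ℤ³)`, so the arm events pull back to a surely non-increasing sequence
with intersection the pull-back of `{|C(0)| = ∞}`). [folklore] -/
theorem stub_thetaInf : ∀ p t : ℝ, (labelMeasure (Site 3)).real {U | {e | e ∈ (zdGraph 3).edgeSet ∧ (((∃ x : Site 3, e = s(x, x + Pi.single (2 : Fin 3) 1)) ∧ U e ≤ t) ∨ (¬ (∃ x : Site 3, e = s(x, x + Pi.single (2 : Fin 3) 1)) ∧ U e ≤ p))} ∈ percolatesAt (0 : Site 3)} = ⨅ n : ℕ, (labelMeasure (Site 3)).real {U | {e | e ∈ (zdGraph 3).edgeSet ∧ (((∃ x : Site 3, e = s(x, x + Pi.single (2 : Fin 3) 1)) ∧ U e ≤ t) ∨ (¬ (∃ x : Site 3, e = s(x, x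 + Pi.single (2 : Fin 3) 1)) ∧ U e ≤ p))} ∈ siteToBoundary 3 n} := by
  intro p t
  have := isProbabilityMeasure_labelMeasure (Site 3)
  exact ThetaInf.measureReal_setOf_mem_percolatesAt_eq_iInf (labelMeasure (Site 3))
    (ThetaInf.measurable_cfg p t) (fun U e he => he.1)

end Summit.CriticalPhenomena.PercolationContinuityZ3.Cruxes.CriticalCurveRegular.Locmod

end
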